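import Summits.ABC.IUTFork.Cor312GenuineKWildDifferent
import Literature.IUT.LogVolume.UnitRadicalDifferent
import HarnessLib

/-!
# [IUTchIII] Cor. 3.12, branch C / R-W window table — the WILD different at the `K`-level pilot datum, type W2:
# at every fibre point `x₀ ∣ p ∈ {3, 5}` over a pole of `j` of order `2t` with `p ∣ t` and `u^{p−1} ≢ 1 (mod p²)`
# (`u = q₀·p^{−2t} ≡ j⁻¹p^{−2t}` the unit part of the Tate parameter): `p ∣ e` and `v(𝔇) ≥ e + e/p − 1`

PROOF-ONLY support file (D-0012; 0 definitions, 0 `Prop` facts) of the abc-iut cell (R-W «WINDOW Θ-SIDE INEQUALITY», seat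
abc-iut-W-neg-1 gen 2; GAP G-Wnum2-1 «WILD LOCAL-TYPE LEMMA», type W2 of abc-iut W-num-2's N1-WILD-EXACT; plan C-R71 (2)).
TAKES NO SIDE on [IUTchIII] Cor. 3.12 (S. Mochizuki, *Inter-universal Teichmüller theory III*, Cor. 3.12 p. 173–174) or on any author.

Sequel of `Cor312GenuineKWildDifferent` (type W1, `p ∤ t`). Here `p ∣ t`: the `p`-th root `ρ` of the Tate parameter
`q₀ ∈ ℚ_p` in `K_{x₀}` (Silverman ATAEC V.5.3 on the `F`-rational `p`-torsion, as there) gives `y = ρ/p^{2t/p}` with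
`y^p = u := q₀·p^{−2t}`, a UNIT; by the `q`-expansion (`‖1/j(q) − q‖ ≤ ‖q‖²`, the tree's `norm_inv_tateJ_sub_le`)
`u ≡ w := j(q)⁻¹·p^{−2t} (mod p²)`, so `u^{p−1} ≢ 1 (mod p²)` iff the RATIONAL number `w^{p−1} − 1` has `p`-adic valuation
exactly `1` — the hypothesis `hunit` below (decidable per datum; W-num-2: «u ≢ ±1 (mod 9)» at `3`, «u⁴ ≢ 1 (mod 25)» at `5`).
Then this seat's `Literature.IUT.LogVolume.UnitRadicalDifferent` (Hecke / Serre III §6: `ℚ_p(u^{1/p})` totally wildly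
ramified, `d ≥ 1 + (e/p − 1)/e` by [IUTchIV] Prop. 1.3 (i)) applies:

* `GenuineK.exists_pow_prime_eq_unit_kOf_ratPoint` — the unit radical `y^p = u`, `‖u‖ = 1`, `‖u − w‖ ≤ p⁻²`;
* **`GenuineK.prime_dvd_absRamificationIdx_kOf_wildUnit_ratPoint`** — `p ∣ e(K_{x₀}/ℚ_p)`;
* **`GenuineK.add_div_sub_one_div_le_differentOrd_kOf_wildUnit_ratPoint`** — `(e + e/p − 1)/e ≤ d(K_{x₀})`;
* `GenuineK.add_div_sub_one_le_multiplicity_differentIdeal_placeOf_wildUnit_ratPoint` — `e + e/p − 1 ≤ ord_u 𝔇_{K/ℤ}`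
  (`u = placeOf x₀`) — W-num-2's exact `δ_w = (e_t − 1) + e_t·δ_W`, `(e_W, δ_W) = (6, 7), (20, 23)`.

HONEST FRAMING: bookkeeping over OUR typed objects (classical Tate-curve and local-field theory); nothing here bears on the
printed inequality of [IUTchIII] Cor. 3.12 or on the number-level `Cor22.Cor312AtDatum`; typed ≠ proved; instantiated ≠ endorsed.
[cite: Mochizuki2012, IUTchIV Thm. 1.10 p. 22] [cite: SilvermanATAEC1994, V.5 Thm. 5.3 and Lemma V.5.1 (PDF pp. 406–409)]
[cite: SerreLocalFields1979, Ch. III §6 Prop. 13] [claim: Mochizuki2012, status: disputed] for every IUT quotation.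
-/

noncomputable section

open NumberField IsDedekindDomain

namespace Summit.ABC.IUTFork.Conditional

open Thm311 Thm311.Real Cor312 Cor312Prov Literature.IUT.LogVolume Literature.IUT.HodgeTheaters
  Literature.IUT.LogThetaLattice Literature.NumberTheory.NumberFields Literature.NumberTheory.DiophantineGeometry.GenEll
  Literature.NumberTheory.DiophantineGeometry Literature.NumberTheory.EllipticCurves
  Literature.NumberTheory.EllipticCurves.TateCurve

/-! ## 0. Auxiliary -/

open scoped Classical in
/-- Push-forward of a finset of `F`-points killed by `n` along a field extension `F → L` (injective on points).
[folklore] -/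
private theorem exists_finset_torsion_map' {F : Type} [Field F] (E : WeierstrassCurve F) {L : Type} [Field L]
    [Algebra F L] {n : ℕ} (S : Finset (E.toAffine.baseChange F).Point) (hS : ∀ Q ∈ S, n • Q = 0) :
    ∃ S' : Finset (E.baseChange L).toAffine.Point, S'.card = S.card ∧ ∀ Q ∈ S', n • Q = 0 := by
  let f : F →ₐ[F] L := Algebra.ofId F L
  let ι : (E.toAffine.baseChange F).Point →+ (E.toAffine.baseChange L).Point :=
    WeierstrassCurve.Affine.Point.map f
  have hι : Function.Injective ι := WeierstrassCurve.Affine.Point.map_injective f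
  refine ⟨S.map ⟨ι, hι⟩, by rw [Finset.card_map], fun Q hQ => ?_⟩
  obtain ⟨Q₀, hQ₀, rfl⟩ := Finset.mem_map.mp hQ
  show n • ι Q₀ = 0
  rw [← map_nsmul, hS Q₀ hQ₀, map_zero]

/-- **Unit criterion transfer**: if `‖u − w‖ ≤ p⁻²` and `‖w^{p−1} − 1‖ = p⁻¹` (so `w`, `u` are units) then `‖u^{p−1} − 1‖ = p⁻¹`
(`u^{p−1} − w^{p−1} = (u − w)·Σ uⁱ w^{p−2−i}` has norm `≤ p⁻²`). [folklore] -/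
private theorem norm_pow_sub_one_eq_of_norm_sub_le {p : ℕ} [Fact p.Prime] {u w : ℚ_[p]} (hw1 : ‖w‖ ≤ 1)
    (huw : ‖u - w‖ ≤ (p : ℝ)⁻¹ * (p : ℝ)⁻¹) (hw : ‖w ^ (p - 1) - 1‖ = (p : ℝ)⁻¹) :
    ‖u ^ (p - 1) - 1‖ = (p : ℝ)⁻¹ := by
  have hp1 : (1 : ℝ) < p := by exact_mod_cast (Fact.out : p.Prime).one_lt
  have hpinv : (p : ℝ)⁻¹ < 1 := inv_lt_one_of_one_lt₀ hp1
  have hpinv0 : (0 : ℝ) < (p : ℝ)⁻¹ := by positivity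
  have hu1 : ‖u‖ ≤ 1 := by
    have h : u = (u - w) + w := by ring
    rw [h]
    exact (IsUltrametricDist.norm_add_le_max _ _).trans
      (max_le (huw.trans (mul_le_one₀ hpinv.le hpinv0.le hpinv.le)) hw1)
  have hgeom : (∑ i ∈ Finset.range (p - 1), u ^ i * w ^ (p - 1 - 1 - i)) * (u - w) = u ^ (p - 1) - w ^ (p - 1) :=
    (Commute.all u w).geom_sum₂_mul (p - 1)
  have hdiff : ‖u ^ (p - 1) - w ^ (p - 1)‖ ≤ (p : ℝ)⁻¹ * (p : ℝ)⁻¹ := by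
    rw [← hgeom, norm_mul]
    have hs : ‖∑ i ∈ Finset.range (p - 1), u ^ i * w ^ (p - 1 - 1 - i)‖ ≤ 1 := by
      refine IsUltrametricDist.norm_sum_le_of_forall_le_of_nonneg zero_le_one fun i _ => ?_
      rw [norm_mul, norm_pow, norm_pow]
      exact mul_le_one₀ (pow_le_one₀ (norm_nonneg _) hu1) (by positivity) (pow_le_one₀ (norm_nonneg _) hw1)
    calc _ ≤ 1 * ((p : ℝ)⁻¹ * (p : ℝ)⁻¹) := mul_le_mul hs huw (norm_nonneg _) zero_le_one
      _ = _ := one_mul _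
  have hlt : ‖u ^ (p - 1) - w ^ (p - 1)‖ < ‖w ^ (p - 1) - 1‖ := by
    rw [hw]
    calc _ ≤ (p : ℝ)⁻¹ * (p : ℝ)⁻¹ := hdiff
      _ < (p : ℝ)⁻¹ * 1 := by gcongr
      _ = _ := mul_one _
  have hsplit : u ^ (p - 1) - 1 = (u ^ (p - 1) - w ^ (p - 1)) + (w ^ (p - 1) - 1) := by ring
  rw [hsplit, IsUltrametricDist.norm_add_eq_max_of_norm_ne_norm hlt.ne, max_eq_right hlt.le, hw]

/-- The unit criterion read off the rational number `w = j⁻¹p^{−2t}`: `‖u‖ = 1`, `‖u − w‖ ≤ p⁻²` and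
`v_p(w^{p−1} − 1) = 1` give `‖u^{p−1} − 1‖ = p⁻¹`. [folklore] -/
private theorem norm_pow_sub_one_eq_of_norm_sub_le_of_padicValRat (p : ℕ) [Fact p.Prime] {u : ℚ_[p]} {w : ℚ}
    (hu1 : ‖u‖ = 1) (huw : ‖u - (w : ℚ_[p])‖ ≤ (p : ℝ)⁻¹ * (p : ℝ)⁻¹)
    (hunit : padicValRat p (w ^ (p - 1) - 1) = 1) :
    ‖u ^ (p - 1) - 1‖ = (p : ℝ)⁻¹ := by
  have hp1 : (1 : ℝ) < p := by exact_mod_cast (Fact.out : p.Prime).one_lt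
  have hpinv : (p : ℝ)⁻¹ < 1 := inv_lt_one_of_one_lt₀ hp1
  have hpinv0 : (0 : ℝ) < (p : ℝ)⁻¹ := by positivity
  -- `‖w‖ ≤ 1` (indeed `= 1`)
  have hw1 : ‖(w : ℚ_[p])‖ ≤ 1 := by
    have h : (w : ℚ_[p]) = u + -(u - w) := by ring
    rw [h]
    refine (IsUltrametricDist.norm_add_le_max _ _).trans (max_le hu1.le ?_)
    rw [norm_neg]
    exact huw.trans (mul_le_one₀ hpinv.le hpinv0.le hpinv.le)
  -- `‖w^{p−1} − 1‖ = p⁻¹` from the valuation of the rational number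
  have hr0 : w ^ (p - 1) - 1 ≠ 0 := by
    intro h0
    rw [h0, padicValRat.zero] at hunit
    exact zero_ne_one hunit
  have hw : ‖(w : ℚ_[p]) ^ (p - 1) - 1‖ = (p : ℝ)⁻¹ := by
    have hcast : (w : ℚ_[p]) ^ (p - 1) - 1 = ((w ^ (p - 1) - 1 : ℚ) : ℚ_[p]) := by push_cast; ring
    rw [hcast, Padic.norm_eq_zpow_neg_valuation (by exact_mod_cast hr0), Padic.valuation_ratCast, hunit, zpow_neg,
      zpow_one]
  exact norm_pow_sub_one_eq_of_norm_sub_le hw1 huw hw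

/-! ## 1. The unit radical in `K_{x₀}` at a W2 packet -/

/-- **A unit radical in `K_{x₀}`**: for a genuine Θ-volume datum `T` at a RATIONAL point `(ratPoint q, l)`, a prime
`p ∈ {3,5}` (`p ∣ 30`, `p ≠ 2`) at which `j(q)` has a pole of order `2t` with `p ∣ t`, and every fibre point `x₀ ∣ p` of the
pilot datum: there are `u ∈ ℚ_p` with `‖u‖ = 1`, `‖u − j(q)⁻¹p^{−2t}‖ ≤ p⁻²`, and `y ∈ K_{x₀}` with `y^p = u` (`u = q₀·p^{−2t}` for
the Tate parameter `q₀ = ρ^p`, `y = ρ/p^{2t/p}`; `‖q₀ − 1/j‖ ≤ ‖q₀‖²`). [cite: SilvermanATAEC1994, V.5 Thm. 5.3 and Lemma V.5.1 (PDF pp. 406–409)]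
[cite: Mochizuki2012, IUTchIV Thm. 1.10 p. 22] [claim: Mochizuki2012, status: disputed] -/
theorem GenuineK.exists_pow_prime_eq_unit_kOf_ratPoint {q : ℚ} {l : ℕ} (T : Cor22.ThetaVolumeDatumAt (ratPoint q) l)
    (pp : Nat.Primes) (hp30 : (pp : ℕ) ∣ 30) (hp2 : (pp : ℕ) ≠ 2) {t : ℕ} (ht : 0 < t) (hpt : (pp : ℕ) ∣ t)
    (hpole : ∀ v : HeightOneSpectrum (𝓞 ℚ), Rat.HeightOneSpectrum.natGenerator v = pp →
      Literature.IUT.LogVolume.ord ℚ v (Cor22.jInv q) = -(2 * (t : ℤ))) :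
    letI := T.instFieldF; letI := T.instNumberFieldF; letI := T.instAlgebraF; letI := T.instFieldK
    letI := T.instNumberFieldK; letI := T.instAlgebraK; letI := T.instFieldFbar; letI := T.instAlgebraFbar
    letI := T.instAlgebraKFbar; letI := T.instIsElliptic
    haveI : Fact (pp : ℕ).Prime := ⟨pp.2⟩
    ∀ x₀ : (thetaIndex (pilotDataOfK T.D T.K)).Fibre (.inr pp),
      ∃ (u : ℚ_[pp]) (y : kOf (pilotDataOfK T.D T.K) pp.1 x₀),
        ‖u‖ = 1 ∧ ‖u - (((Cor22.jInv q)⁻¹ / ((pp : ℕ) : ℚ) ^ (2 * t) : ℚ) : ℚ_[pp])‖ ≤ ((pp : ℕ) : ℝ)⁻¹ * ((pp : ℕ) : ℝ)⁻¹ ∧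
        y ^ (pp : ℕ) = algebraMap ℚ_[pp] (kOf (pilotDataOfK T.D T.K) pp.1 x₀) u := by
  letI := T.instFieldF; letI := T.instNumberFieldF; letI := T.instAlgebraF; letI := T.instFieldK
  letI := T.instNumberFieldK; letI := T.instAlgebraK; letI := T.instFieldFbar; letI := T.instAlgebraFbar
  letI := T.instAlgebraKFbar; letI := T.instIsElliptic
  haveI : Fact (pp : ℕ).Prime := ⟨pp.2⟩
  have hpp : (pp : ℕ).Prime := pp.2
  set X := pilotDataOfK T.D T.K with hXdef
  intro x₀
  set u := placeOf X pp.1 x₀ with hudef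
  have hpu : ((pp : ℕ) : 𝓞 T.K) ∈ u.asIdeal := natCast_mem_placeOf X pp.1 x₀
  -- the completion `K_u` and the structure map `F → K → K_u`
  set Ku : Type := kOf X pp.1 x₀ with hKudef
  let f : T.F →+* Ku :=
    (RescaledCompletion.of T.K pp.1 u hpu).toRingHom.comp
      ((algebraMap T.K (u.adicCompletion T.K)).comp (algebraMap T.F T.K))
  letI algFKu : Algebra T.F Ku := f.toAlgebra
  haveI : CharZero Ku := charZero_of_injective_algebraMap (algebraMap ℚ_[pp] Ku).injective
  -- the curve `E_F ⊗ K_u` and its `j`-invariant `j(q) ∈ ℚ ⊆ ℚ_p`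
  haveI hEK : (T.E.baseChange Ku).IsElliptic := inferInstanceAs (T.E.map (algebraMap T.F Ku)).IsElliptic
  set j₀ : ℚ_[pp] := ((Cor22.jInv q : ℚ) : ℚ_[pp]) with hj₀def
  have hjK : (T.E.baseChange Ku).j = algebraMap ℚ_[pp] Ku j₀ := by
    have h1 : (T.E.baseChange Ku).j = algebraMap T.F Ku T.E.j := T.E.map_j (algebraMap T.F Ku)
    rw [h1, T.j_eq, hj₀def, map_ratCast]
    exact eq_ratCast ((algebraMap T.F Ku).comp (algebraMap (ratPoint q).F T.F)) (Cor22.jInv q)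
  -- the place of `ℚ` under `u` is the pole `p`
  set v : HeightOneSpectrum (𝓞 ℚ) := finBelow (ratPoint q).F T.F (finBelow T.F T.K u) with hvdef
  have huchar : residueChar T.K u = (pp : ℕ) := residueChar_eq_of_natCast_mem pp.1 hpu
  have hvp : Rat.HeightOneSpectrum.natGenerator v = pp := by
    have hchar : residueChar ℚ v = pp := by
      rw [hvdef]
      change residueChar (ratPoint q).F (finBelow (ratPoint q).F T.F (finBelow T.F T.K u)) = pp
      rw [residueChar_finBelow, residueChar_finBelow, huchar]
    have hmem : ((pp : ℕ) : 𝓞 ℚ) ∈ v.asIdeal := by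
      rw [Cor22.natCast_mem_asIdeal_iff_residueChar_eq v pp.2]; exact hchar
    have hdvd := (UniformABCConjecture.natCast_mem_asIdeal_iff v pp).1 hmem
    exact (Nat.prime_dvd_prime_iff_eq (Rat.HeightOneSpectrum.prime_natGenerator v) pp.2).1 hdvd
  -- `|j|_p = p^{2t} > 1`
  have hordj := hpole v hvp
  have hj0 : (Cor22.jInv q : ℚ) ≠ 0 := by
    intro h0
    rw [h0, ord_zero] at hordj
    have : (0 : ℤ) < t := by exact_mod_cast ht
    omega
  have hval : padicValRat pp (Cor22.jInv q) = -(2 * (t : ℤ)) := by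
    rw [← hvp, ← GenuineK.ord_rat_eq_padicValRat v hj0, hordj]
  have hpR1 : (1 : ℝ) < ((pp : ℕ) : ℝ) := by exact_mod_cast hpp.one_lt
  have hpR0 : (0 : ℝ) < ((pp : ℕ) : ℝ) := by positivity
  have hj₀0 : j₀ ≠ 0 := by rw [hj₀def]; exact_mod_cast hj0
  have hj₀norm : ‖j₀‖ = ((pp : ℕ) : ℝ) ^ (((2 * t : ℕ) : ℤ)) := by
    rw [Padic.norm_eq_zpow_neg_valuation hj₀0, hj₀def, Padic.valuation_ratCast, hval]
    congr 1
    push_cast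
    ring
  have hj₀gt : 1 < ‖j₀‖ := by
    rw [hj₀norm]
    exact one_lt_zpow₀ hpR1 (by have : 0 < t := ht; omega)
  have hjKgt : 1 < ‖(T.E.baseChange Ku).j‖ := by rw [hjK, norm_algebraMap']; exact hj₀gt
  -- `p²` rational `p`-torsion points over `K_u`, so the Tate parameter of `E_F ⊗ K_u` is a `p`-th power
  obtain ⟨S, hS, hSp⟩ := T.exists_finset_torsion_F (n := (pp : ℕ)) hpp.pos hp30
  obtain ⟨S', hS', hS'p⟩ := exists_finset_torsion_map' T.E (L := Ku) S hSp
  have hodd : Odd (pp : ℕ) := hpp.odd_of_ne_two hp2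
  obtain ⟨qK, ρ, hqK0, hqK1, hqKj, -, hρ⟩ :=
    exists_tateParameter_pow_of_odd_torsion (T.E.baseChange Ku) hjKgt hodd S' hS'p (by rw [hS', hS])
  -- the `ℚ_p`-Tate parameter `q₀` of `j(q)`, and `q_E = q₀·1` by uniqueness
  obtain ⟨q₀, ⟨hq₀0, hq₀1, hq₀j⟩, -⟩ := existsUnique_tateJ_eq_of_one_lt_norm hj₀gt
  have hq₀K : tateJ (algebraMap ℚ_[pp] Ku q₀) = (T.E.baseChange Ku).j := by
    rw [tateJ_algebraMap Ku hq₀1, hq₀j, hjK]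
  have hq₀K0 : algebraMap ℚ_[pp] Ku q₀ ≠ 0 := (map_ne_zero _).mpr hq₀0
  have hq₀K1 : ‖algebraMap ℚ_[pp] Ku q₀‖ < 1 := by rw [norm_algebraMap']; exact hq₀1
  have hqeq : qK = algebraMap ℚ_[pp] Ku q₀ :=
    tateParameter_unique (E := T.E.baseChange Ku) hqK0 hqK1 hqKj hq₀K0 hq₀K1 hq₀K
  have hq₀norm : ‖q₀‖ = ((pp : ℕ) : ℝ) ^ (-(((2 * t : ℕ) : ℤ))) := by
    have h := norm_tateJ_eq hq₀1
    rw [hq₀j, hj₀norm] at h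
    rw [zpow_neg, h, inv_inv]
  -- the unit `u = q₀ / p^{2t}` and the radical `y = ρ / p^{2t/p}`
  have hP : ((pp : ℕ) : ℝ) ≠ 0 := hpR0.ne'
  have hp2t : (pp : ℕ) ∣ 2 * t := dvd_mul_of_dvd_right hpt 2
  refine ⟨q₀ / ((pp : ℕ) : ℚ_[pp]) ^ (2 * t), ρ / ((pp : ℕ) : Ku) ^ (2 * t / pp), ?_, ?_, ?_⟩
  · -- `‖u‖ = 1`
    rw [norm_div, norm_pow, hq₀norm, Padic.norm_p, inv_pow, ← zpow_natCast ((pp : ℕ) : ℝ) (2 * t), ← zpow_neg,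
      div_self (zpow_ne_zero _ hP)]
  · -- `‖u − j⁻¹/p^{2t}‖ ≤ p⁻²`: `u − w = (q₀ − j₀⁻¹)/p^{2t}` and `‖q₀ − j₀⁻¹‖ ≤ ‖q₀‖²`
    have hw : (((Cor22.jInv q)⁻¹ / ((pp : ℕ) : ℚ) ^ (2 * t) : ℚ) : ℚ_[pp]) = j₀⁻¹ / ((pp : ℕ) : ℚ_[pp]) ^ (2 * t) := by
      rw [hj₀def]; push_cast; ring
    rw [hw, ← sub_div, norm_div, norm_pow, Padic.norm_p, inv_pow, ← zpow_natCast ((pp : ℕ) : ℝ) (2 * t), ← zpow_neg]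
    have hq : ‖q₀ - j₀⁻¹‖ ≤ ((pp : ℕ) : ℝ) ^ (-(((2 * t : ℕ) : ℤ))) * ((pp : ℕ) : ℝ) ^ (-(((2 * t : ℕ) : ℤ))) := by
      rw [← hq₀norm, norm_sub_rev, ← hq₀j]
      exact norm_inv_tateJ_sub_le hq₀1
    rw [div_le_iff₀ (zpow_pos hpR0 _)]
    refine hq.trans ?_
    rw [← zpow_add₀ hP, ← zpow_neg_one, ← zpow_add₀ hP, ← zpow_add₀ hP]
    refine zpow_le_zpow_right₀ hpR1.le ?_
    push_cast
    omega
  · -- `y^p = u`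
    have h1 : (ρ / ((pp : ℕ) : Ku) ^ (2 * t / pp)) ^ (pp : ℕ) = ρ ^ (pp : ℕ) / ((pp : ℕ) : Ku) ^ (2 * t) := by
      rw [div_pow, ← pow_mul, Nat.div_mul_cancel hp2t]
    rw [h1, hρ, hqeq, map_div₀, map_pow, map_natCast]

/-! ## 2. Consequences at a W2 packet: `p ∣ e`, `(e + e/p − 1)/e ≤ d`, `e + e/p − 1 ≤ ord_u 𝔇_{K/ℤ}` -/

/-- **`p ∣ e(K_{x₀}/ℚ_p)` at every fibre point over a W2 wild pole** (`p ∈ {3,5}`, `ord_p j(q) = −2t`, `p ∣ t`, and the unit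
criterion `v_p((j(q)⁻¹p^{−2t})^{p−1} − 1) = 1`, i.e. `u ≢ ±1 (mod 9)` / `u⁴ ≢ 1 (mod 25)`).
[cite: SerreLocalFields1979, Ch. III §6 Prop. 13] [cite: Mochizuki2012, IUTchIV Thm. 1.10 p. 22] [claim: Mochizuki2012, status: disputed] -/
theorem GenuineK.prime_dvd_absRamificationIdx_kOf_wildUnit_ratPoint {q : ℚ} {l : ℕ}
    (T : Cor22.ThetaVolumeDatumAt (ratPoint q) l)
    (pp : Nat.Primes) (hp30 : (pp : ℕ) ∣ 30) (hp2 : (pp : ℕ) ≠ 2) {t : ℕ} (ht : 0 < t) (hpt : (pp : ℕ) ∣ t)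
    (hpole : ∀ v : HeightOneSpectrum (𝓞 ℚ), Rat.HeightOneSpectrum.natGenerator v = pp →
      Literature.IUT.LogVolume.ord ℚ v (Cor22.jInv q) = -(2 * (t : ℤ)))
    (hunit : padicValRat pp ((((Cor22.jInv q)⁻¹ / ((pp : ℕ) : ℚ) ^ (2 * t)) ^ ((pp : ℕ) - 1) - 1)) = 1) :
    letI := T.instFieldF; letI := T.instNumberFieldF; letI := T.instAlgebraF; letI := T.instFieldK
    letI := T.instNumberFieldK; letI := T.instAlgebraK; letI := T.instFieldFbar; letI := T.instAlgebraFbar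
    letI := T.instAlgebraKFbar; letI := T.instIsElliptic
    haveI : Fact (pp : ℕ).Prime := ⟨pp.2⟩
    ∀ x₀ : (thetaIndex (pilotDataOfK T.D T.K)).Fibre (.inr pp),
      (pp : ℕ) ∣ absRamificationIdx (pp : ℕ) (kOf (pilotDataOfK T.D T.K) pp.1 x₀) := by
  haveI : Fact (pp : ℕ).Prime := ⟨pp.2⟩
  intro x₀
  obtain ⟨u, y, hu1, huw, hy⟩ := GenuineK.exists_pow_prime_eq_unit_kOf_ratPoint T pp hp30 hp2 ht hpt hpole x₀
  have hu := norm_pow_sub_one_eq_of_norm_sub_le_of_padicValRat (pp : ℕ) hu1 huw hunit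
  exact prime_dvd_absRamificationIdx_of_norm_eq_rpow (pp : ℕ)
    (norm_pow_sub_one_pred_sub_one_of_pow_prime_eq_unit (pp : ℕ) hu hy)

/-- **`(e + e/p − 1)/e ≤ d(K_{x₀})` at every fibre point over a W2 wild pole** (`e = e(K_{x₀}/ℚ_p)`, `d` the normalised order of
the different): W-num-2's exact `δ_w = (e_t − 1) + e_t·δ_W` with `(e_W, δ_W) = (6, 7)` at `3`, `(20, 23)` at `5` (N1-WILD-EXACT L5,
type W2). [cite: SerreLocalFields1979, Ch. III §6 Prop. 13] [cite: Mochizuki2012, IUTchIV Prop. 1.3 (i) p. 11 and Thm. 1.10 p. 22]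
[claim: Mochizuki2012, status: disputed] -/
theorem GenuineK.add_div_sub_one_div_le_differentOrd_kOf_wildUnit_ratPoint {q : ℚ} {l : ℕ}
    (T : Cor22.ThetaVolumeDatumAt (ratPoint q) l)
    (pp : Nat.Primes) (hp30 : (pp : ℕ) ∣ 30) (hp2 : (pp : ℕ) ≠ 2) {t : ℕ} (ht : 0 < t) (hpt : (pp : ℕ) ∣ t)
    (hpole : ∀ v : HeightOneSpectrum (𝓞 ℚ), Rat.HeightOneSpectrum.natGenerator v = pp →
      Literature.IUT.LogVolume.ord ℚ v (Cor22.jInv q) = -(2 * (t : ℤ)))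
    (hunit : padicValRat pp ((((Cor22.jInv q)⁻¹ / ((pp : ℕ) : ℚ) ^ (2 * t)) ^ ((pp : ℕ) - 1) - 1)) = 1) :
    letI := T.instFieldF; letI := T.instNumberFieldF; letI := T.instAlgebraF; letI := T.instFieldK
    letI := T.instNumberFieldK; letI := T.instAlgebraK; letI := T.instFieldFbar; letI := T.instAlgebraFbar
    letI := T.instAlgebraKFbar; letI := T.instIsElliptic
    haveI : Fact (pp : ℕ).Prime := ⟨pp.2⟩
    ∀ x₀ : (thetaIndex (pilotDataOfK T.D T.K)).Fibre (.inr pp),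
      ((absRamificationIdx (pp : ℕ) (kOf (pilotDataOfK T.D T.K) pp.1 x₀) +
            absRamificationIdx (pp : ℕ) (kOf (pilotDataOfK T.D T.K) pp.1 x₀) / pp - 1 : ℕ) : ℝ) /
          (absRamificationIdx (pp : ℕ) (kOf (pilotDataOfK T.D T.K) pp.1 x₀) : ℝ) ≤
        differentOrd (pp : ℕ) (kOf (pilotDataOfK T.D T.K) pp.1 x₀) := by
  haveI : Fact (pp : ℕ).Prime := ⟨pp.2⟩
  intro x₀
  obtain ⟨u, y, hu1, huw, hy⟩ := GenuineK.exists_pow_prime_eq_unit_kOf_ratPoint T pp hp30 hp2 ht hpt hpole x₀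
  have hu := norm_pow_sub_one_eq_of_norm_sub_le_of_padicValRat (pp : ℕ) hu1 huw hunit
  exact add_div_sub_one_div_le_differentOrd_of_pow_prime_eq_unit (pp : ℕ) hu hy

/-- **Global form: `e(u∣p) + e(u∣p)/p − 1 ≤ ord_u(𝔇_{K/ℤ})`** at the place `u = placeOf x₀` of `K` under a W2 fibre point
(`d(K_u) = ord_u(𝔇_{K/ℤ})/e(u|p)`, the tree's `differentOrd_rescaledCompletion`).
[cite: SerreLocalFields1979, Ch. III §4 Prop. 10 and §6 Prop. 13] [cite: Mochizuki2012, IUTchIV Thm. 1.10 p. 22]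
[claim: Mochizuki2012, status: disputed] -/
theorem GenuineK.add_div_sub_one_le_multiplicity_differentIdeal_placeOf_wildUnit_ratPoint {q : ℚ} {l : ℕ}
    (T : Cor22.ThetaVolumeDatumAt (ratPoint q) l)
    (pp : Nat.Primes) (hp30 : (pp : ℕ) ∣ 30) (hp2 : (pp : ℕ) ≠ 2) {t : ℕ} (ht : 0 < t) (hpt : (pp : ℕ) ∣ t)
    (hpole : ∀ v : HeightOneSpectrum (𝓞 ℚ), Rat.HeightOneSpectrum.natGenerator v = pp →
      Literature.IUT.LogVolume.ord ℚ v (Cor22.jInv q) = -(2 * (t : ℤ)))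
    (hunit : padicValRat pp ((((Cor22.jInv q)⁻¹ / ((pp : ℕ) : ℚ) ^ (2 * t)) ^ ((pp : ℕ) - 1) - 1)) = 1) :
    letI := T.instFieldF; letI := T.instNumberFieldF; letI := T.instAlgebraF; letI := T.instFieldK
    letI := T.instNumberFieldK; letI := T.instAlgebraK; letI := T.instFieldFbar; letI := T.instAlgebraFbar
    letI := T.instAlgebraKFbar; letI := T.instIsElliptic
    haveI : Fact (pp : ℕ).Prime := ⟨pp.2⟩
    ∀ x₀ : (thetaIndex (pilotDataOfK T.D T.K)).Fibre (.inr pp),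
      (placeOf (pilotDataOfK T.D T.K) pp.1 x₀).asIdeal.ramificationIdx ℤ +
          (placeOf (pilotDataOfK T.D T.K) pp.1 x₀).asIdeal.ramificationIdx ℤ / pp - 1 ≤
        multiplicity (placeOf (pilotDataOfK T.D T.K) pp.1 x₀).asIdeal (differentIdeal ℤ (𝓞 T.K)) := by
  letI := T.instFieldF; letI := T.instNumberFieldF; letI := T.instAlgebraF; letI := T.instFieldK
  letI := T.instNumberFieldK; letI := T.instAlgebraK; letI := T.instFieldFbar; letI := T.instAlgebraFbar
  letI := T.instAlgebraKFbar; letI := T.instIsElliptic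
  haveI : Fact (pp : ℕ).Prime := ⟨pp.2⟩
  set X := pilotDataOfK T.D T.K with hXdef
  intro x₀
  set u := placeOf X pp.1 x₀ with hudef
  have hpu : ((pp : ℕ) : 𝓞 T.K) ∈ u.asIdeal := natCast_mem_placeOf X pp.1 x₀
  have h := GenuineK.add_div_sub_one_div_le_differentOrd_kOf_wildUnit_ratPoint T pp hp30 hp2 ht hpt hpole hunit x₀
  have he : absRamificationIdx (pp : ℕ) (kOf X pp.1 x₀) = u.asIdeal.ramificationIdx ℤ := by
    rw [show absRamificationIdx (pp : ℕ) (kOf X pp.1 x₀) =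
        absRamificationIdx (pp : ℕ) (RescaledCompletion T.K pp.1 (placeOf X pp.1 x₀) hpu) from rfl,
      absRamificationIdx_rescaledCompletion]
  have hd : differentOrd (pp : ℕ) (kOf X pp.1 x₀) =
      (multiplicity u.asIdeal (differentIdeal ℤ (𝓞 T.K)) : ℝ) / (u.asIdeal.ramificationIdx ℤ : ℝ) := by
    rw [show differentOrd (pp : ℕ) (kOf X pp.1 x₀) =
        differentOrd (pp : ℕ) (RescaledCompletion T.K pp.1 (placeOf X pp.1 x₀) hpu) from rfl,
      differentOrd_rescaledCompletion]
  rw [he, hd] at h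
  have he0 : (0 : ℝ) < (u.asIdeal.ramificationIdx ℤ : ℝ) := by exact_mod_cast Ideal.ramificationIdx_pos _ _
  rw [div_le_div_iff_of_pos_right he0] at h
  exact_mod_cast h

end Summit.ABC.IUTFork.Conditional

end
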